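import Literature.Analysis.Convexity.AnisotropicPerimeter
import HarnessLib

/-!
# Subadditivity of the anisotropic perimeter over disjoint unions

Topic `Literature/Analysis/Convexity`; a one-lemma companion of `AnisotropicPerimeter.lean`
(`anisotropicPerimeter K A = sup {∫_A div φ : φ ∈ C¹_c(V; K)}`, Maggi (20.2)). For disjoint
measurable `A, B`: `P_K(A ∪ B) ≤ P_K(A) + P_K(B)` — each admissible field integrates additively
over `A ∪ B` and the suprema separate. In the vocabulary of the venture `Summits/Ventures/Crystal3D`
(crux `PolycrystalWulffBound`) this says the interface term
`ι_K(A,B) = (P_K(A) + P_K(B) − P_K(A ∪ B))/2` of two grains is nonnegative. (Additivity of `ι_K`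
over disjoint unions of THREE sets is NOT elementary in the distributional setting — it needs the
structure theory of sets of finite perimeter — and is not claimed here.)

## References
* F. Maggi, *Sets of Finite Perimeter and Geometric Variational Problems*, CUP 2012, (20.2)
  p. 258. [`Maggi2012`]
-/

noncomputable section

open MeasureTheory Set Filter Function Metric
open scoped ENNReal Topology Pointwise

namespace Literature.Analysis.Convexity

open Literature.MathematicalPhysics.StatisticalMechanics (fieldDivergence)

variable {V : Type*} [NormedAddCommGroup V] [InnerProductSpace ℝ V] [FiniteDimensional ℝ V]
  [MeasurableSpace V] [BorelSpace V]

/-! ### Subadditivity over disjoint unions: interfaces carry nonnegative measure -/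

omit [MeasurableSpace V] [BorelSpace V] in
/-- The divergence of a `C¹` field is continuous (trace of the continuous derivative). [folklore] -/
private theorem continuous_fieldDivergence {φ : V → V} (hφ : ContDiff ℝ 1 φ) :
    Continuous (fieldDivergence φ) := by
  have h1 : Continuous (fderiv ℝ φ) := hφ.continuous_fderiv one_ne_zero
  let T : (V →L[ℝ] V) →ₗ[ℝ] ℝ := (LinearMap.trace ℝ V).comp (ContinuousLinearMap.coeLM ℝ)
  have hT : Continuous T := T.continuous_of_finiteDimensional
  exact hT.comp h1

omit [FiniteDimensional ℝ V] [MeasurableSpace V] [BorelSpace V] in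
/-- The divergence of a compactly supported `C¹` field has compact support. [folklore] -/
private theorem hasCompactSupport_fieldDivergence {φ : V → V} (hc : HasCompactSupport φ) :
    HasCompactSupport (fieldDivergence φ) := by
  have h : fieldDivergence φ = (fun A : V →L[ℝ] V => LinearMap.trace ℝ V (A : V →ₗ[ℝ] V)) ∘
      fderiv ℝ φ := rfl
  rw [h]
  exact (hc.fderiv ℝ).comp_left (by simp)

/-- **Subadditivity of the `K`-perimeter over disjoint unions**:
`P_K(A ∪ B) ≤ P_K(A) + P_K(B)` for disjoint measurable `A, B` (each admissible field integrates
additively over `A ∪ B`; the suprema separate). Equivalently, the interface term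
`ι_K(A,B) = (P_K(A) + P_K(B) − P_K(A ∪ B))/2` of a Caccioppoli partition is nonnegative.
[cite: Maggi2012, (20.2) p. 258] -/
theorem anisotropicPerimeter_union_le (K : Set V) {A B : Set V} (hB : MeasurableSet B)
    (hAB : Disjoint A B) :
    anisotropicPerimeter K (A ∪ B) ≤ anisotropicPerimeter K A + anisotropicPerimeter K B := by
  refine anisotropicPerimeter_le_iff.2 fun φ h₁ h₂ h₃ => ?_
  have hint : Integrable (fieldDivergence φ) volume :=
    (continuous_fieldDivergence h₁).integrable_of_hasCompactSupport
      (hasCompactSupport_fieldDivergence h₂)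
  rw [setIntegral_union hAB hB hint.integrableOn hint.integrableOn]
  exact ENNReal.ofReal_add_le.trans
    (add_le_add (le_anisotropicPerimeter h₁ h₂ h₃) (le_anisotropicPerimeter h₁ h₂ h₃))
end Literature.Analysis.Convexity

end
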